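import Literature.Computability.Complexity.ClockedUniversalAcceptanceProofs
import Literature.Computability.Complexity.FPStringBricks
import Literature.Computability.Complexity.PlumbingBricks
import Literature.Computability.Complexity.HashBricks
import HarnessLib

/-!
# The claimed quantities of a clocked flat run are ONE polynomial-time language

Toolkit over the tree's efficient universal machine (`UniversalStep.lean`: the universal step
`UnivStep.ustepFn ∈ FP` on string codes `⟨program, ⟨pc, stacks⟩⟩` of flat configurations;
`FlatPrograms.lean`, `TM2StdNormal.lean`: every bundled machine `M : Turing.TM2ComputableAux
Bool Bool` is, through its halting guard, standardisation and input recoding, a flat program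
`ClockedUA.PM M` with the two-way interface `FlatProg.pflat_complete` / `FlatProg.pflat_sound`;
`ClockedUniversalAcceptanceProofs.lean`: the clocked orbit of the guarded universal step is
polynomial-time, `iterate_mem_FP_of_growth`). It packages, for ONE machine `M` and a time
budget `Tm` (a polynomial), all the quantities of the run that an `EVAL`-type argument asks a
guessed circuit to claim (R. Williams, J. ACM 61 (2014), proof of Lemma 3.1: "consider the
problem: given `x`, an input `i` … and a gate index `j`, output the bit value on the output wire
of the `j`th gate when `C_x` is evaluated on `i`. By assumption, this problem also has `ACC`
circuits, since `C_x` can be constructed and evaluated on any input `i` in polynomial time";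
C. D. Murray, R. R. Williams, STOC 2018, §5: "Clearly EVAL-GATE is computable in polynomial
time. By assumption (A), EVAL-GATE has `C`-circuits") into ONE language of `P`, so that a
hypothesis "`P` has small circuits" yields ONE circuit answering all of them:

* instances `FlatClaim.mkI z κ τ k p t = ⟨z, ⟨κ, ⟨τ, ⟨k, ⟨p, t⟩⟩⟩⟩⟩` (input word `z` of `M`;
  raw bit fields read as numbers: kind `κ`, time `τ`, stack `k`, height `p`, bit `t`);
* `FlatClaim.cfgAt M Tm z τ` — the flat configuration of `M` on `z` after `min τ Tm(|z|)`
  steps; `FlatClaim.cfgC` computes its CODE in polynomial time (`FlatClaim.cfgC_mkI`): the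
  per-machine guarded universal step `FlatClaim.FF M` (guard: the step may grow the code by at
  most `gM M = 6 (|encProg P| + 1)` symbols, which honest codes always satisfy,
  `UnivStep.length_enc_step_le`; no uniformity in `M` is needed here, so the guard is a
  constant), its clocked orbit `FlatClaim.orbitF M ∈ FP` from `⟨1^{min τ Tm(|z|)}, initial code⟩`
  (`FlatClaim.orbitF_enc`: `|u|` honest rounds are `|u|` flat steps), the initial code through
  `ClockedUA.ι` / `ClockedUA.inst` (`FlatClaim.code₀_apply`);
* the extraction, by the tree's list bricks (`nthLF`, `takeRevLF`, `dropLF`, `bitAtFn`,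
  `binToUnaryFn`, within the budget `B(|z|) = Tm(|z|) + |z|`, which covers every stack of the
  clocked configuration, `FlatClaim.length_stk_cfgAt_le`), of: a bit of the program counter
  (kind `0`), the OCCUPANCY bit "stack `k` has a symbol at height `p` from the bottom" (kind
  `1`), a bit of that symbol (kind `2`), the emptiness bit of stack `k` (kind `3`), a bit of its
  top symbol (kind `≥ 4`) — heights are counted from the BOTTOM, the representation in which one
  flat step is local (`FlatProgLocality.lean`);
* **`FlatClaim.claimFn M Tm ∈ FP`** (a total `0/1` function, `FlatClaim.normBit`),
  **`FlatClaim.claimLang M Tm ∈ P`** (`FlatClaim.claimLang_mem_P`), and the semantics on every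
  instance: **`FlatClaim.claimFn_pc`**, **`FlatClaim.claimFn_occ`**, **`FlatClaim.claimFn_cell`**,
  **`FlatClaim.claimFn_topEmpty`**, **`FlatClaim.claimFn_top`** (in terms of
  `cfgAt M Tm z τ`: `bin pc`, `(S.getD k []).length`, `(S.getD k []).reverse.getD p 0`,
  `S.getD k [] = []`, `(S.getD k []).headD 0`, i.e. the `FlatProg.stk`/`ssize`/`cellB`/`top` of
  `FlatProgLocality.lean` unfolded);
* `FlatClaim.cfgAt_eq_phaltCfg` — past `haltAddr · s` steps the clocked configuration of a
  computation halting within `s` steps is the flat halting configuration with the output word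
  on the output stack (`FlatProg.pflat_complete`).

Everything is proved; no named fact. With `FlatProgLocality.lean` (locally consistent claims
ARE the run) this is the machine-independent half of the consistency check of the
exponential-level simulation behind `MurrayWilliams2018ExpLevel.lean` (a guessed `AC⁰[m]`
circuit for `claimLang M Tm` restricted to one `z`, `M` the clause machine of a succinct
reduction, is verified by `AC⁰[m]`-SAT calls on local consistency conditions and then read at
the output stack).

## References

* R. Williams, *Nonuniform ACC circuit lower bounds*, J. ACM 61(1) (2014) 2:1–2:32, Lemma 3.1
  and its proof (pp. 10–12) [Williams2014].
* C. D. Murray, R. R. Williams, *Circuit lower bounds for nondeterministic quasi-polytime: an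
  easy witness lemma for NP and NQP*, STOC 2018, §5 (EVAL-GATE) [MurrayWilliams2018].
* S. Arora, B. Barak, *Computational Complexity: A Modern Approach*, CUP 2009, §1.4, Thm. 1.9
  and §1.4.1 (efficient universal machine with a time bound) [AroraBarakCC2009].
-/

noncomputable section

namespace Literature.Computability.Complexity

namespace FlatClaim

open _root_.Computability Polynomial Brick Plumb Turing UnivStep FlatProg ClockedUA HashBricks

variable (M : TM2ComputableAux Bool Bool)

/-! ### The guarded universal step of ONE machine and its clocked orbit -/

/-- The growth allowance of one flat step of the program of `M`: `6 (|encProg P| + 1)`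
(`UnivStep.length_enc_step_le`). [folklore] -/
def gM : ℕ := 6 * ((encProg (PM M)).length + 1)

/-- The guard `[|ustepFn z| ≤ |z| + gM]` on states `⟨u, z⟩`. [folklore] -/
def guardF : List Bool → List Bool :=
  lenLeFn (X + Polynomial.C (gM M)) ∘ fanoutFn sndF (ustepFn ∘ sndF)

/-- The guarded step on the second component. [folklore] -/
def GF : List Bool → List Bool := iteFn (guardF M) (ustepFn ∘ sndF) sndF

/-- **The guarded universal step of `M`** on states `⟨u, z⟩`: `⟨u, ustepFn z⟩` if the step grows
`z` by at most `gM M` symbols (honest codes always qualify), `⟨u, z⟩` otherwise. [cite: AroraBarakCC2009, Thm. 1.9 and §1.4.1] -/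
def FF : List Bool → List Bool := fanoutFn fstF (GF M)

/-- Value of the guard. [folklore] -/
theorem guardF_apply (Z : List Bool) :
    guardF M Z = [decide ((ustepFn (sndF Z)).length ≤ (sndF Z).length + gM M)] := by
  simp [guardF, lenLeFn_boolPair]

/-- Value of the guarded step. [folklore] -/
theorem GF_apply (Z : List Bool) :
    GF M Z = if (ustepFn (sndF Z)).length ≤ (sndF Z).length + gM M then ustepFn (sndF Z) else sndF Z := by
  by_cases h : (ustepFn (sndF Z)).length ≤ (sndF Z).length + gM M
  · rw [GF, iteFn_apply_true (by rw [guardF_apply, decide_eq_true h]), if_pos h]; rfl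
  · rw [GF, iteFn_apply_false (by rw [guardF_apply, decide_eq_false h]), if_neg h]

/-- The guarded step grows the second component by at most `gM M`. [folklore] -/
theorem length_GF_le (Z : List Bool) : (GF M Z).length ≤ (sndF Z).length + gM M := by
  rw [GF_apply]
  split_ifs with h
  · exact h
  · exact Nat.le_add_right _ _

/-- Value of `FF`. [folklore] -/
theorem FF_apply (Z : List Bool) : FF M Z = boolPair (fstF Z) (GF M Z) := fanoutFn_apply _ _ _

/-- `FF` keeps the first component. [folklore] -/
theorem fst_FF (Z : List Bool) : (boolUnpair (FF M Z)).1 = (boolUnpair Z).1 := by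
  rw [FF_apply, boolUnpair_boolPair]; rfl

/-- Growth of `FF`: at most `gM M + 2` symbols per round. [folklore] -/
theorem length_FF_le (Z : List Bool) :
    (FF M Z).length ≤ Z.length + (gM M + 2) * ((boolUnpair Z).1.length + 1) := by
  rw [FF_apply, length_boolPair]
  have h1 := length_GF_le M Z
  have h2 := length_fstF_sndF_le Z
  have h3 : (boolUnpair Z).1 = fstF Z := rfl
  rw [h3]
  nlinarith

/-- `guardF M ∈ FP`. [folklore] -/
theorem guardF_mem_FP : guardF M ∈ FP :=
  comp_mem_FP (lenLeFn_mem_FP _) (fanoutFn_mem_FP sndF_mem_FP (comp_mem_FP ustepFn_mem_FP sndF_mem_FP))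

/-- `GF M ∈ FP`. [folklore] -/
theorem GF_mem_FP : GF M ∈ FP :=
  iteFn_mem_FP (guardF_mem_FP M) (comp_mem_FP ustepFn_mem_FP sndF_mem_FP) sndF_mem_FP

/-- `FF M ∈ FP`. [folklore] -/
theorem FF_mem_FP : FF M ∈ FP := fanoutFn_mem_FP fstF_mem_FP (GF_mem_FP M)

/-- **The clocked orbit**: `|u|` rounds of `FF M` from `⟨u, z⟩`. [cite: AroraBarakCC2009, §1.4.1 (a time counter)] -/
def orbitF : List Bool → List Bool := fun Z => (FF M)^[(X : Polynomial ℕ).eval (boolUnpair Z).1.length] Z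

/-- **The clocked orbit is polynomial-time** (`iterate_mem_FP_of_growth`). [cite: AroraBarakCC2009, Thm. 1.9 and §1.4.1] -/
theorem orbitF_mem_FP : orbitF M ∈ FP :=
  iterate_mem_FP_of_growth (FF_mem_FP M) (gM M + 2) (fst_FF M) (length_FF_le M) X

/-- **One honest round is one flat step**: on `⟨u, enc P cfg⟩` with `cfg` having `nK` stacks
the guard holds and the universal step is correct. [cite: AroraBarakCC2009, Thm. 1.9] -/
theorem FF_enc (u : List Bool) (cfg : Cfg) (hlen : cfg.2.length = (cM M).nK) :
    FF M (boolPair u (UnivStep.enc (PM M) cfg)) = boolPair u (UnivStep.enc (PM M) (step (PM M) cfg)) := by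
  rw [FF_apply, fstF_boolPair, GF_apply, sndF_boolPair]
  have hstep : ustepFn (UnivStep.enc (PM M) cfg) = UnivStep.enc (PM M) (step (PM M) cfg) :=
    ustepFn_enc _ _ fun i hi => by rw [hlen]; exact wf_of_getElem?_compile _ hi
  rw [hstep, if_pos (show (UnivStep.enc (PM M) (step (PM M) cfg)).length ≤
    (UnivStep.enc (PM M) cfg).length + gM M from length_enc_step_le (PM M) cfg)]

/-- **The honest orbit is the flat run**, for any number of rounds. [cite: AroraBarakCC2009, Thm. 1.9 and §1.4.1] -/
theorem iterate_FF_enc (u : List Bool) (cfg : Cfg) (hlen : cfg.2.length = (cM M).nK) (n : ℕ) :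
    (FF M)^[n] (boolPair u (UnivStep.enc (PM M) cfg)) = boolPair u (UnivStep.enc (PM M) ((step (PM M))^[n] cfg)) := by
  induction n with
  | zero => rfl
  | succ n ih =>
    rw [Function.iterate_succ_apply', ih,
      FF_enc M u _ (length_snd_iterate_step _ n _ hlen), Function.iterate_succ_apply']

/-- The orbit of an honest state: `|u|` flat steps. [cite: AroraBarakCC2009, §1.4.1] -/
theorem orbitF_enc (u : List Bool) (cfg : Cfg) (hlen : cfg.2.length = (cM M).nK) :
    orbitF M (boolPair u (UnivStep.enc (PM M) cfg)) = boolPair u (UnivStep.enc (PM M) ((step (PM M))^[u.length] cfg)) := by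
  simp only [orbitF, boolUnpair_boolPair, eval_X]
  exact iterate_FF_enc M u cfg hlen u.length

/-! ### The initial code of `M` on `z` -/

/-- `z ↦ enc P (flat initial configuration of M on z)`, through the instance coding of
`ClockedUniversalAcceptanceProofs.lean` (`ClockedUA.ι (ClockedUA.inst M z ε)`). [cite: AroraBarakCC2009, §1.4.1] -/
def code₀ : List Bool → List Bool :=
  ι ∘ fanoutFn (fun _ => ClockedUA.code M) (fanoutFn (fun w => w) (fun _ => []))

/-- Value of `code₀`. [folklore] -/
theorem code₀_apply (z : List Bool) : code₀ M z = UnivStep.enc (PM M) (pinitCfg M (π M) z) := by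
  rw [code₀, Function.comp_apply, fanoutFn_apply, fanoutFn_apply]
  exact ι_inst M z []

/-- `code₀ M ∈ FP`. [folklore] -/
theorem code₀_mem_FP : code₀ M ∈ FP :=
  comp_mem_FP ι_mem_FP (fanoutFn_mem_FP (const_mem_FP _) (fanoutFn_mem_FP id_mem_FP (const_mem_FP _)))

/-! ### Instances `⟨z, ⟨κ, ⟨τ, ⟨k, ⟨p, t⟩⟩⟩⟩⟩` and the clocked configuration code -/

/-- The instance with input word `z`, kind `κ`, time `τ`, stack `k`, height `p` and bit `t`
(raw bit fields, read as numbers by `bitsToNat`; nested pair code). [folklore] -/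
def mkI (z κ τ k p t : List Bool) : List Bool :=
  boolPair z (boolPair κ (boolPair τ (boolPair k (boolPair p t))))

/-- Field: the input word. [folklore] -/
def zI : List Bool → List Bool := nthF 0
/-- Field: the kind. [folklore] -/
def κI : List Bool → List Bool := nthF 1
/-- Field: the time. [folklore] -/
def τI : List Bool → List Bool := nthF 2
/-- Field: the stack. [folklore] -/
def kI : List Bool → List Bool := nthF 3
/-- Field: the height. [folklore] -/
def pI : List Bool → List Bool := nthF 4
/-- Field: the bit. [folklore] -/
def tI : List Bool → List Bool := sndPow 4

/-- The field `zI` of an instance. [folklore] -/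
@[simp] theorem zI_mkI (z κ τ k p t : List Bool) : zI (mkI z κ τ k p t) = z := by simp [zI, mkI]
/-- The field `κI` of an instance. [folklore] -/
@[simp] theorem κI_mkI (z κ τ k p t : List Bool) : κI (mkI z κ τ k p t) = κ := by simp [κI, mkI]
/-- The field `τI` of an instance. [folklore] -/
@[simp] theorem τI_mkI (z κ τ k p t : List Bool) : τI (mkI z κ τ k p t) = τ := by simp [τI, mkI]
/-- The field `kI` of an instance. [folklore] -/
@[simp] theorem kI_mkI (z κ τ k p t : List Bool) : kI (mkI z κ τ k p t) = k := by simp [kI, mkI]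
/-- The field `pI` of an instance. [folklore] -/
@[simp] theorem pI_mkI (z κ τ k p t : List Bool) : pI (mkI z κ τ k p t) = p := by simp [pI, mkI]
/-- The field `tI` of an instance. [folklore] -/
@[simp] theorem tI_mkI (z κ τ k p t : List Bool) : tI (mkI z κ τ k p t) = t := by simp [tI, mkI]

/-- `zI` is polynomial-time. [folklore] -/
theorem zI_mem_FP : zI ∈ FP := nthF_mem_FP 0
/-- `κI` is polynomial-time. [folklore] -/
theorem κI_mem_FP : κI ∈ FP := nthF_mem_FP 1
/-- `τI` is polynomial-time. [folklore] -/
theorem τI_mem_FP : τI ∈ FP := nthF_mem_FP 2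
/-- `kI` is polynomial-time. [folklore] -/
theorem kI_mem_FP : kI ∈ FP := nthF_mem_FP 3
/-- `pI` is polynomial-time. [folklore] -/
theorem pI_mem_FP : pI ∈ FP := nthF_mem_FP 4
/-- `tI` is polynomial-time. [folklore] -/
theorem tI_mem_FP : tI ∈ FP := sndPow_mem_FP 4

variable (Tm : Polynomial ℕ)

/-- The budget polynomial `B = Tm + X`: a bound on the time, on stack indices, on heights and on
the number of symbols of a stack (`|z| + τ`). [folklore] -/
def bpoly : Polynomial ℕ := Tm + X

/-- The clock `1^{min τ Tm(|z|)}` of an instance. [cite: AroraBarakCC2009, §1.4.1 (a time counter)] -/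
def τu : List Bool → List Bool := binToUnaryFn ∘ fanoutFn (polyFn Tm ∘ zI) τI

/-- The initial state `⟨clock, initial code⟩` of an instance. [folklore] -/
def Z₀ : List Bool → List Bool := fanoutFn (τu Tm) (code₀ M ∘ zI)

/-- **The code of the clocked configuration** of an instance: the flat configuration of `M` on
`z` after `min τ Tm(|z|)` steps. [cite: AroraBarakCC2009, Thm. 1.9 and §1.4.1] -/
def cfgC : List Bool → List Bool := sndF ∘ orbitF M ∘ Z₀ M Tm

/-- The clocked configuration of an instance. [folklore] -/
def cfgAt (z τ : List Bool) : Cfg :=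
  (step (PM M))^[min (bitsToNat τ) (Tm.eval z.length)] (pinitCfg M (π M) z)

/-- The clock of an instance. [folklore] -/
theorem τu_mkI (z κ τ k p t : List Bool) :
    τu Tm (mkI z κ τ k p t) = ones (min (bitsToNat τ) (Tm.eval z.length)) := by
  simp [τu, binToUnaryFn_boolPair, min_comm]

/-- **The configuration code of an instance is the code of its clocked configuration.**
[cite: AroraBarakCC2009, Thm. 1.9 and §1.4.1] -/
theorem cfgC_mkI (z κ τ k p t : List Bool) :
    cfgC M Tm (mkI z κ τ k p t) = UnivStep.enc (PM M) (cfgAt M Tm z τ) := by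
  rw [cfgC, Function.comp_apply, Function.comp_apply, Z₀, fanoutFn_apply, τu_mkI,
    Function.comp_apply, zI_mkI, code₀_apply, orbitF_enc M _ _ (length_pinitCfg_snd M z),
    sndF_boolPair, cfgAt]
  simp

/-- `τu` is polynomial-time. [folklore] -/
theorem τu_mem_FP : τu Tm ∈ FP :=
  comp_mem_FP binToUnaryFn_mem_FP (fanoutFn_mem_FP (comp_mem_FP (polyFn_mem_FP _) zI_mem_FP) τI_mem_FP)

/-- `Z₀` is polynomial-time. [folklore] -/
theorem Z₀_mem_FP : Z₀ M Tm ∈ FP :=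
  fanoutFn_mem_FP (τu_mem_FP Tm) (comp_mem_FP (code₀_mem_FP M) zI_mem_FP)

/-- `cfgC` is polynomial-time. [folklore] -/
theorem cfgC_mem_FP : cfgC M Tm ∈ FP :=
  comp_mem_FP sndF_mem_FP (comp_mem_FP (orbitF_mem_FP M) (Z₀_mem_FP M Tm))

/-! ### Extraction of the claimed quantities from a state `⟨instance, configuration code⟩` -/

section Extract

/-- The budget `1^{B(|z|)}` of a state. [folklore] -/
def budW : List Bool → List Bool := polyFn (bpoly Tm) ∘ zI ∘ fstF

/-- The canonical numeral of a field of a state. [folklore] -/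
def canon (f : List Bool → List Bool) : List Bool → List Bool := addFn ∘ fanoutFn f fun _ => []

/-- A field of the instance of a state, in unary, capped by the budget. [folklore] -/
def unaryOf (f : List Bool → List Bool) : List Bool → List Bool :=
  binToUnaryFn ∘ fanoutFn (budW Tm) (f ∘ fstF)

/-- The program-counter numeral of a state. [folklore] -/
def pcNumW : List Bool → List Bool := pcF ∘ sndF

/-- The code of stack `k` of a state (`k` read off the instance). [folklore] -/
def stkW : List Bool → List Bool :=
  nthLF ∘ fanoutFn (budW Tm) (fanoutFn (canon (kI ∘ fstF)) (ssF ∘ sndF))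

/-- The coded list of the symbols of stack `k`, BOTTOM first. [folklore] -/
def revW : List Bool → List Bool :=
  takeRevLF ∘ fanoutFn (budW Tm) (fanoutFn (popCountFn ∘ onesFn ∘ budW Tm) (stkW Tm))

/-- The coded list of the symbols of stack `k` from height `p` on. [folklore] -/
def dropW : List Bool → List Bool :=
  dropLF ∘ fanoutFn (budW Tm) (fanoutFn (canon (pI ∘ fstF)) (revW Tm))

/-- The occupancy bit of height `p` of stack `k`. [folklore] -/
def occW : List Bool → List Bool := notFn (isNilFn ∘ dropW Tm)

/-- The numeral of the symbol at height `p` of stack `k`. [folklore] -/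
def cellNumW : List Bool → List Bool := fstF ∘ dropW Tm

/-- The emptiness bit of stack `k`. [folklore] -/
def topEmptyW : List Bool → List Bool := isNilFn ∘ stkW Tm

/-- The numeral of the top symbol of stack `k`. [folklore] -/
def topNumW : List Bool → List Bool := fstF ∘ stkW Tm

/-- Bit `t` (read off the instance) of a numeral-valued quantity of a state, `0` past its end.
[folklore] -/
def bitOf (num : List Bool → List Bool) : List Bool → List Bool :=
  iteFn (isNilFn ∘ bitAtFn ∘ fanoutFn (unaryOf Tm tI) num) (fun _ => [false])
    (bitAtFn ∘ fanoutFn (unaryOf Tm tI) num)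

/-- The kind test `[κ < c]`. [folklore] -/
def kindLt (c : ℕ) : List Bool → List Bool := ltFn ∘ fanoutFn (κI ∘ fstF) fun _ => encodeNat c

/-- **The answer** on a state, by kind: `0` a bit of the program counter, `1` an occupancy bit,
`2` a bit of a cell symbol, `3` the emptiness bit of a stack, `≥ 4` a bit of a top symbol.
[folklore] -/
def answerW : List Bool → List Bool :=
  iteFn (kindLt 1) (bitOf Tm pcNumW)
    (iteFn (kindLt 2) (occW Tm)
      (iteFn (kindLt 3) (bitOf Tm (cellNumW Tm))
        (iteFn (kindLt 4) (topEmptyW Tm) (bitOf Tm (topNumW Tm)))))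

end Extract

/-- Normalisation of a one-bit answer: `[f z = [1]]` (a total `0/1` function). [folklore] -/
def normBit (f : List Bool → List Bool) : List Bool → List Bool :=
  iteFn (eqPairFn ∘ fanoutFn f fun _ => [true]) (fun _ => [true]) fun _ => [false]

/-- Value of `normBit`. [folklore] -/
theorem normBit_apply (f : List Bool → List Bool) (z : List Bool) :
    normBit f z = [decide (f z = [true])] := by
  by_cases h : f z = [true]
  · rw [normBit, iteFn_apply_true (by simp [fanoutFn_apply, eqPairFn_boolPair, h]), decide_eq_true h]
  · rw [normBit, iteFn_apply_false (by simp [fanoutFn_apply, eqPairFn_boolPair, h]), decide_eq_false h]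

/-- On a one-bit value `normBit` is the identity. [folklore] -/
theorem normBit_of_eq (f : List Bool → List Bool) {z : List Bool} {b : Bool} (h : f z = [b]) :
    normBit f z = [b] := by
  rw [normBit_apply, h]; cases b <;> simp

/-- `normBit` is polynomial-time. [folklore] -/
theorem normBit_mem_FP {f : List Bool → List Bool} (hf : f ∈ FP) : normBit f ∈ FP :=
  iteFn_mem_FP (comp_mem_FP eqPairFn_mem_FP (fanoutFn_mem_FP hf (const_mem_FP _)))
    (const_mem_FP _) (const_mem_FP _)

/-- **The claim function of `M` with time bound `Tm`** (a total `0/1` function).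
[cite: Williams2014, Lemma 3.1 (proof: "given input i and a gate index j, E produces the output of gate j")] -/
def claimFn : List Bool → List Bool := normBit (answerW Tm ∘ fanoutFn (fun w => w) (cfgC M Tm))

/-! ### Membership in `FP` -/

/-- `budW` is polynomial-time. [folklore] -/
theorem budW_mem_FP : budW Tm ∈ FP :=
  comp_mem_FP (polyFn_mem_FP _) (comp_mem_FP zI_mem_FP fstF_mem_FP)

/-- `canon` is polynomial-time. [folklore] -/
theorem canon_mem_FP {f : List Bool → List Bool} (hf : f ∈ FP) : canon f ∈ FP :=
  comp_mem_FP addFn_mem_FP (fanoutFn_mem_FP hf (const_mem_FP _))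

/-- `unaryOf` is polynomial-time. [folklore] -/
theorem unaryOf_mem_FP {f : List Bool → List Bool} (hf : f ∈ FP) : unaryOf Tm f ∈ FP :=
  comp_mem_FP binToUnaryFn_mem_FP (fanoutFn_mem_FP (budW_mem_FP Tm) (comp_mem_FP hf fstF_mem_FP))

/-- `pcNumW` is polynomial-time. [folklore] -/
theorem pcNumW_mem_FP : pcNumW ∈ FP := comp_mem_FP pcF_mem_FP sndF_mem_FP

/-- `stkW` is polynomial-time. [folklore] -/
theorem stkW_mem_FP : stkW Tm ∈ FP :=
  comp_mem_FP nthLF_mem_FP (fanoutFn_mem_FP (budW_mem_FP Tm)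
    (fanoutFn_mem_FP (canon_mem_FP (comp_mem_FP kI_mem_FP fstF_mem_FP)) (comp_mem_FP ssF_mem_FP sndF_mem_FP)))

/-- `revW` is polynomial-time. [folklore] -/
theorem revW_mem_FP : revW Tm ∈ FP :=
  comp_mem_FP takeRevLF_mem_FP (fanoutFn_mem_FP (budW_mem_FP Tm)
    (fanoutFn_mem_FP (comp_mem_FP popCountFn_mem_FP (comp_mem_FP onesFn_mem_FP (budW_mem_FP Tm)))
      (stkW_mem_FP Tm)))

/-- `dropW` is polynomial-time. [folklore] -/
theorem dropW_mem_FP : dropW Tm ∈ FP :=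
  comp_mem_FP dropLF_mem_FP (fanoutFn_mem_FP (budW_mem_FP Tm)
    (fanoutFn_mem_FP (canon_mem_FP (comp_mem_FP pI_mem_FP fstF_mem_FP)) (revW_mem_FP Tm)))

/-- `occW` is polynomial-time. [folklore] -/
theorem occW_mem_FP : occW Tm ∈ FP := notFn_mem_FP (comp_mem_FP isNilFn_mem_FP (dropW_mem_FP Tm))

/-- `cellNumW` is polynomial-time. [folklore] -/
theorem cellNumW_mem_FP : cellNumW Tm ∈ FP := comp_mem_FP fstF_mem_FP (dropW_mem_FP Tm)

/-- `topEmptyW` is polynomial-time. [folklore] -/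
theorem topEmptyW_mem_FP : topEmptyW Tm ∈ FP := comp_mem_FP isNilFn_mem_FP (stkW_mem_FP Tm)

/-- `topNumW` is polynomial-time. [folklore] -/
theorem topNumW_mem_FP : topNumW Tm ∈ FP := comp_mem_FP fstF_mem_FP (stkW_mem_FP Tm)

/-- `bitOf` is polynomial-time. [folklore] -/
theorem bitOf_mem_FP {num : List Bool → List Bool} (h : num ∈ FP) : bitOf Tm num ∈ FP := by
  have hb : bitAtFn ∘ fanoutFn (unaryOf Tm tI) num ∈ FP :=
    comp_mem_FP bitAtFn_mem_FP (fanoutFn_mem_FP (unaryOf_mem_FP Tm tI_mem_FP) h)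
  exact iteFn_mem_FP (comp_mem_FP isNilFn_mem_FP hb) (const_mem_FP _) hb

/-- `kindLt` is polynomial-time. [folklore] -/
theorem kindLt_mem_FP (c : ℕ) : kindLt c ∈ FP :=
  comp_mem_FP ltFn_mem_FP (fanoutFn_mem_FP (comp_mem_FP κI_mem_FP fstF_mem_FP) (const_mem_FP _))

/-- `answerW` is polynomial-time. [folklore] -/
theorem answerW_mem_FP : answerW Tm ∈ FP :=
  iteFn_mem_FP (kindLt_mem_FP 1) (bitOf_mem_FP Tm pcNumW_mem_FP)
    (iteFn_mem_FP (kindLt_mem_FP 2) (occW_mem_FP Tm)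
      (iteFn_mem_FP (kindLt_mem_FP 3) (bitOf_mem_FP Tm (cellNumW_mem_FP Tm))
        (iteFn_mem_FP (kindLt_mem_FP 4) (topEmptyW_mem_FP Tm) (bitOf_mem_FP Tm (topNumW_mem_FP Tm)))))

/-- **The claim function is polynomial-time.** [cite: AroraBarakCC2009, Thm. 1.9 and §1.4.1] -/
theorem claimFn_mem_FP : claimFn M Tm ∈ FP :=
  normBit_mem_FP (comp_mem_FP (answerW_mem_FP Tm) (fanoutFn_mem_FP id_mem_FP (cfgC_mem_FP M Tm)))

/-- The claim function answers one bit on every input. [folklore] -/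
theorem claimFn_eq (y : List Bool) :
    claimFn M Tm y = [decide ((answerW Tm ∘ fanoutFn (fun w => w) (cfgC M Tm)) y = [true])] :=
  normBit_apply _ _

/-- **The claim language of `M` with time bound `Tm`.** [cite: Williams2014, Lemma 3.1 (proof)] -/
def claimLang : Language Bool := {y | claimFn M Tm y = [true]}

/-- **The claim language is in `P`.** [cite: AroraBarakCC2009, Thm. 1.9 and §1.4.1] -/
theorem claimLang_mem_P : claimLang M Tm ∈ Classes.P :=
  mem_P_of_mem_FP (claimFn_mem_FP M Tm) _ fun y =>
    ⟨id, fun h => by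
      have h' : claimFn M Tm y ≠ [true] := h
      rw [claimFn_eq] at h' ⊢
      by_cases hb : (answerW Tm ∘ fanoutFn (fun w => w) (cfgC M Tm)) y = [true]
      · exact absurd (by rw [decide_eq_true hb]) h'
      · rw [decide_eq_false hb]⟩

/-! ### Semantics of the extraction on honest states -/

section Semantics

variable {M Tm}

/-- `(S.map encStack)[k] = encStack S[k]` with the empty defaults. [folklore] -/
theorem getD_map_encStack (S : List (List ℕ)) (k : ℕ) :
    (S.map encStack).getD k [] = encStack (S.getD k []) := by
  rw [show ([] : List Bool) = encStack [] from rfl, List.getD_map]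

/-- `bin 0 = ε`. [folklore] -/
theorem bin_zero : bin 0 = [] := by decide

/-- The head of a coded symbol list. [folklore] -/
theorem headD_map_bin (l : List ℕ) : (l.map bin).headD [] = bin (l.headD 0) := by
  cases l with
  | nil => exact bin_zero.symm
  | cons a l => rfl

/-- The head of a dropped list is the indexed element. [folklore] -/
theorem headD_drop (l : List ℕ) (n : ℕ) : (l.drop n).headD 0 = l.getD n 0 := by
  rw [List.headD_eq_head?_getD, List.head?_drop, List.getD_eq_getElem?_getD]

variable (z κ τ k p t : List Bool) (cfg : Cfg)

/-- The honest state of an instance and a configuration. [folklore] -/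
abbrev W : List Bool := boolPair (mkI z κ τ k p t) (UnivStep.enc (PM M) cfg)

/-- The budget of an honest state. [folklore] -/
theorem budW_W : budW Tm (W (M := M) z κ τ k p t cfg) = ones ((bpoly Tm).eval z.length) := by
  simp [budW, polyFn_apply]

/-- The canonical numeral of a field. [folklore] -/
theorem canon_apply (f : List Bool → List Bool) (w : List Bool) :
    canon f w = encodeNat (bitsToNat (f w)) := by
  simp [canon, addFn_boolPair]

/-- A field in unary, capped. [folklore] -/
theorem unaryOf_W (f : List Bool → List Bool) :
    unaryOf Tm f (W (M := M) z κ τ k p t cfg) =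
      ones (min (bitsToNat (f (mkI z κ τ k p t))) ((bpoly Tm).eval z.length)) := by
  rw [unaryOf, Function.comp_apply, fanoutFn_apply, budW_W, Function.comp_apply, fstF_boolPair,
    binToUnaryFn_boolPair]
  simp [min_comm]

/-- The program-counter numeral of an honest state. [folklore] -/
theorem pcNumW_W : pcNumW (W (M := M) z κ τ k p t cfg) = bin cfg.1 := by
  obtain ⟨pc, S⟩ := cfg
  rw [pcNumW, Function.comp_apply, sndF_boolPair]
  exact (fields_enc (PM M) pc S).2.1

/-- The code of stack `k` of an honest state (`k` within the budget). [folklore] -/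
theorem stkW_W (hk : bitsToNat k ≤ (bpoly Tm).eval z.length) :
    stkW Tm (W (M := M) z κ τ k p t cfg) = encStack (cfg.2.getD (bitsToNat k) []) := by
  obtain ⟨pc, S⟩ := cfg
  rw [stkW, Function.comp_apply, fanoutFn_apply, fanoutFn_apply, budW_W, canon_apply,
    Function.comp_apply, fstF_boolPair, kI_mkI, Function.comp_apply, sndF_boolPair,
    (fields_enc (PM M) pc S).2.2, encStacks, nthLF_apply _ (by simpa using hk), getD_map_encStack]

/-- The bottom-first symbol list of stack `k` of an honest state (short stack). [folklore] -/
theorem revW_W (hk : bitsToNat k ≤ (bpoly Tm).eval z.length)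
    (hlen : (cfg.2.getD (bitsToNat k) []).length ≤ (bpoly Tm).eval z.length) :
    revW Tm (W (M := M) z κ τ k p t cfg) =
      encList ((cfg.2.getD (bitsToNat k) []).map bin).reverse := by
  have hcount : popCountFn (onesFn (ones ((bpoly Tm).eval z.length))) =
      encodeNat ((bpoly Tm).eval z.length) := by
    rw [popCountFn_apply, onesFn, OracleCompose.unaryEncodeNat_eq_replicate, List.count_replicate_self]
    simp
  rw [revW, Function.comp_apply, fanoutFn_apply, fanoutFn_apply, budW_W, Function.comp_apply,
    Function.comp_apply, budW_W, hcount, stkW_W z κ τ k p t cfg hk, encStack,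
    takeRevLF_apply _ (by simp) _, List.take_of_length_le (by simpa using hlen)]

/-- The symbol list of stack `k` from height `p` on (short stack, `p` within the budget). [folklore] -/
theorem dropW_W (hk : bitsToNat k ≤ (bpoly Tm).eval z.length)
    (hlen : (cfg.2.getD (bitsToNat k) []).length ≤ (bpoly Tm).eval z.length)
    (hp : bitsToNat p ≤ (bpoly Tm).eval z.length) :
    dropW Tm (W (M := M) z κ τ k p t cfg) =
      encList (((cfg.2.getD (bitsToNat k) []).reverse.drop (bitsToNat p)).map bin) := by
  rw [dropW, Function.comp_apply, fanoutFn_apply, fanoutFn_apply, budW_W, canon_apply,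
    Function.comp_apply, fstF_boolPair, pI_mkI, revW_W z κ τ k p t cfg hk hlen,
    dropLF_apply _ (by simpa using hp), ← List.map_reverse, List.map_drop]

/-- **The occupancy bit** of height `p` of stack `k` of an honest state. [folklore] -/
theorem occW_W (hk : bitsToNat k ≤ (bpoly Tm).eval z.length)
    (hlen : (cfg.2.getD (bitsToNat k) []).length ≤ (bpoly Tm).eval z.length)
    (hp : bitsToNat p ≤ (bpoly Tm).eval z.length) :
    occW Tm (W (M := M) z κ τ k p t cfg) =
      [decide (bitsToNat p < (cfg.2.getD (bitsToNat k) []).length)] := by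
  have h : (isNilFn ∘ dropW Tm) (W (M := M) z κ τ k p t cfg) =
      [decide ((cfg.2.getD (bitsToNat k) []).length ≤ bitsToNat p)] := by
    rw [Function.comp_apply, dropW_W z κ τ k p t cfg hk hlen hp, isNilFn]
    congr 1
    exact Bool.decide_congr (by
      rw [encList_eq_nil_iff, List.map_eq_nil_iff, List.drop_eq_nil_iff, List.length_reverse])
  rw [occW, notFn_apply h]
  congr 1
  by_cases hc : bitsToNat p < (cfg.2.getD (bitsToNat k) []).length
  · rw [decide_eq_true hc, decide_eq_false (not_le.2 hc)]; rfl
  · rw [decide_eq_false hc, decide_eq_true (not_lt.1 hc)]; rfl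

/-- **The cell numeral** of height `p` of stack `k` of an honest state. [folklore] -/
theorem cellNumW_W (hk : bitsToNat k ≤ (bpoly Tm).eval z.length)
    (hlen : (cfg.2.getD (bitsToNat k) []).length ≤ (bpoly Tm).eval z.length)
    (hp : bitsToNat p ≤ (bpoly Tm).eval z.length) :
    cellNumW Tm (W (M := M) z κ τ k p t cfg) =
      bin ((cfg.2.getD (bitsToNat k) []).reverse.getD (bitsToNat p) 0) := by
  rw [cellNumW, Function.comp_apply, dropW_W z κ τ k p t cfg hk hlen hp, fstF_encList,
    headD_map_bin, headD_drop]

/-- **The emptiness bit** of stack `k` of an honest state. [folklore] -/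
theorem topEmptyW_W (hk : bitsToNat k ≤ (bpoly Tm).eval z.length) :
    topEmptyW Tm (W (M := M) z κ τ k p t cfg) = [decide (cfg.2.getD (bitsToNat k) [] = [])] := by
  rw [topEmptyW, Function.comp_apply, stkW_W z κ τ k p t cfg hk, isNilFn]
  congr 1
  exact Bool.decide_congr (by rw [encStack, encList_eq_nil_iff, List.map_eq_nil_iff])

/-- **The top numeral** of stack `k` of an honest state. [folklore] -/
theorem topNumW_W (hk : bitsToNat k ≤ (bpoly Tm).eval z.length) :
    topNumW Tm (W (M := M) z κ τ k p t cfg) = bin ((cfg.2.getD (bitsToNat k) []).headD 0) := by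
  rw [topNumW, Function.comp_apply, stkW_W z κ τ k p t cfg hk, encStack, fstF_encList, headD_map_bin]

/-- **A bit of a numeral-valued quantity** of an honest state (`0` past the end). [folklore] -/
theorem bitOf_W (num : List Bool → List Bool) :
    bitOf Tm num (W (M := M) z κ τ k p t cfg) =
      [(num (W (M := M) z κ τ k p t cfg)).getD (min (bitsToNat t) ((bpoly Tm).eval z.length)) false] := by
  set w := W (M := M) z κ τ k p t cfg with hw
  set m := min (bitsToNat t) ((bpoly Tm).eval z.length) with hm
  have hb : (bitAtFn ∘ fanoutFn (unaryOf Tm tI) num) w = ((num w).drop m).take 1 := by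
    rw [Function.comp_apply, fanoutFn_apply, hw, unaryOf_W, tI_mkI, ← hw, ← hm, bitAtFn_boolPair]
    simp
  by_cases hlt : m < (num w).length
  · have hv : ((num w).drop m).take 1 = [(num w).get ⟨m, hlt⟩] :=
      List.take_one_drop_eq_of_lt_length hlt
    rw [bitOf, iteFn_apply_false (by rw [Function.comp_apply, hb, hv]; rfl), hb, hv]
    simp [List.getD_eq_getElem?_getD, List.getElem?_eq_getElem hlt]
  · have hv : ((num w).drop m).take 1 = [] := by
      rw [List.drop_eq_nil_of_le (not_lt.1 hlt), List.take_nil]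
    rw [bitOf, iteFn_apply_true (by rw [Function.comp_apply, hb, hv]; rfl),
      List.getD_eq_default _ _ (not_lt.1 hlt)]

/-- The kind test on an honest state. [folklore] -/
theorem kindLt_W (c : ℕ) : kindLt c (W (M := M) z κ τ k p t cfg) = [decide (bitsToNat κ < c)] := by
  simp [kindLt, ltFn_boolPair]

end Semantics

/-! ### The budget covers the stacks; the answers on instances -/

/-- The flat initial configuration of `M` on `z` carries `|z|` symbols. [folklore] -/
theorem stkTotal_pinitCfg (z : List Bool) : stkTotal (pinitCfg M (π M) z).2 = z.length := by
  rw [pinitCfg_eq]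
  dsimp only
  have hk : ((ucode M).k₀ : ℕ) < (List.replicate (ucode M).nK ([] : List ℕ)).length := by
    rw [List.length_replicate]; exact (ucode M).k₀.isLt
  have h := stkTotal_set _ _ (((inCode M z).map (π M)).map Fin.val) hk
  have h0 : stkTotal (List.replicate (ucode M).nK ([] : List ℕ)) = 0 := by
    simp [stkTotal]
  have hl : (((inCode M z).map (π M)).map Fin.val).length = z.length := by
    simp [FlatProg.inCode, TM2Std.stkCode]
  simp only [List.getElem_replicate, List.length_nil, add_zero, h0, zero_add, hl] at h
  exact h

/-- **The budget covers every stack of the clocked configuration**: stack `k` of `cfgAt M Tm z τ`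
has at most `|z| + min τ Tm(|z|) ≤ B(|z|)` symbols (`FlatProg.stkTotal_iterate_le`). [folklore] -/
theorem length_stk_cfgAt_le (z τ : List Bool) (kk : ℕ) :
    ((cfgAt M Tm z τ).2.getD kk []).length ≤ (bpoly Tm).eval z.length := by
  have hle : ∀ (S : List (List ℕ)) (j : ℕ), (S.getD j []).length ≤ stkTotal S := by
    intro S
    induction S with
    | nil => intro j; simp
    | cons a S ih =>
      intro j
      cases j with
      | zero => simp [stkTotal]
      | succ j =>
        simp only [List.getD_cons_succ, stkTotal, List.map_cons, List.sum_cons]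
        exact (ih j).trans (Nat.le_add_left _ _)
  have h := (hle _ kk).trans (stkTotal_iterate_le (PM M) (pinitCfg M (π M) z)
    (min (bitsToNat τ) (Tm.eval z.length)))
  rw [stkTotal_pinitCfg] at h
  have hB : (bpoly Tm).eval z.length = Tm.eval z.length + z.length := by simp [bpoly]
  rw [hB]
  exact h.trans (by omega)

section Export

variable (z κ τ k p t : List Bool)

/-- The state on which the answer of an instance is computed is the honest state of its
clocked configuration. [folklore] -/
theorem state_mkI : fanoutFn (fun w => w) (cfgC M Tm) (mkI z κ τ k p t) =
    W (M := M) z κ τ k p t (cfgAt M Tm z τ) := by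
  rw [fanoutFn_apply, cfgC_mkI]

/-- **Kind `0`: a bit of the program counter.** For every instance,
`claimFn ⟨z, ⟨κ, ⟨τ, ⟨k, ⟨p, t⟩⟩⟩⟩⟩ = [bit (min t B) of bin pc]`, `pc` the program counter of the
flat configuration of `M` on `z` after `min τ Tm(|z|)` steps. [cite: Williams2014, Lemma 3.1 (proof)] -/
theorem claimFn_pc (hκ : bitsToNat κ = 0) :
    claimFn M Tm (mkI z κ τ k p t) =
      [(bin (cfgAt M Tm z τ).1).getD (min (bitsToNat t) ((bpoly Tm).eval z.length)) false] := by
  apply normBit_of_eq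
  rw [Function.comp_apply, state_mkI, answerW, iteFn_apply_true (by rw [kindLt_W, hκ]; rfl),
    bitOf_W, pcNumW_W]

/-- **Kind `1`: an occupancy bit** — whether stack `k` has a symbol at height `p` (`k`, `p`
within the budget). [cite: Williams2014, Lemma 3.1 (proof)] -/
theorem claimFn_occ (hκ : bitsToNat κ = 1) (hk : bitsToNat k ≤ (bpoly Tm).eval z.length)
    (hp : bitsToNat p ≤ (bpoly Tm).eval z.length) :
    claimFn M Tm (mkI z κ τ k p t) =
      [decide (bitsToNat p < ((cfgAt M Tm z τ).2.getD (bitsToNat k) []).length)] := by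
  apply normBit_of_eq
  rw [Function.comp_apply, state_mkI, answerW, iteFn_apply_false (by rw [kindLt_W, hκ]; rfl),
    iteFn_apply_true (by rw [kindLt_W, hκ]; rfl),
    occW_W z κ τ k p t _ hk (length_stk_cfgAt_le M Tm z τ _) hp]

/-- **Kind `2`: a bit of the symbol at height `p` of stack `k`** (from the bottom; `0` above the
stack). [cite: Williams2014, Lemma 3.1 (proof)] -/
theorem claimFn_cell (hκ : bitsToNat κ = 2) (hk : bitsToNat k ≤ (bpoly Tm).eval z.length)
    (hp : bitsToNat p ≤ (bpoly Tm).eval z.length) :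
    claimFn M Tm (mkI z κ τ k p t) =
      [(bin (((cfgAt M Tm z τ).2.getD (bitsToNat k) []).reverse.getD (bitsToNat p) 0)).getD
        (min (bitsToNat t) ((bpoly Tm).eval z.length)) false] := by
  apply normBit_of_eq
  rw [Function.comp_apply, state_mkI, answerW, iteFn_apply_false (by rw [kindLt_W, hκ]; rfl),
    iteFn_apply_false (by rw [kindLt_W, hκ]; rfl), iteFn_apply_true (by rw [kindLt_W, hκ]; rfl),
    bitOf_W, cellNumW_W z κ τ k p t _ hk (length_stk_cfgAt_le M Tm z τ _) hp]

/-- **Kind `3`: the emptiness bit of stack `k`.** [cite: Williams2014, Lemma 3.1 (proof)] -/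
theorem claimFn_topEmpty (hκ : bitsToNat κ = 3) (hk : bitsToNat k ≤ (bpoly Tm).eval z.length) :
    claimFn M Tm (mkI z κ τ k p t) = [decide ((cfgAt M Tm z τ).2.getD (bitsToNat k) [] = [])] := by
  apply normBit_of_eq
  rw [Function.comp_apply, state_mkI, answerW, iteFn_apply_false (by rw [kindLt_W, hκ]; rfl),
    iteFn_apply_false (by rw [kindLt_W, hκ]; rfl), iteFn_apply_false (by rw [kindLt_W, hκ]; rfl),
    iteFn_apply_true (by rw [kindLt_W, hκ]; rfl), topEmptyW_W z κ τ k p t _ hk]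

/-- **Kind `≥ 4`: a bit of the top symbol of stack `k`** (`0` for an empty stack). [cite: Williams2014, Lemma 3.1 (proof)] -/
theorem claimFn_top (hκ : 4 ≤ bitsToNat κ) (hk : bitsToNat k ≤ (bpoly Tm).eval z.length) :
    claimFn M Tm (mkI z κ τ k p t) =
      [(bin (((cfgAt M Tm z τ).2.getD (bitsToNat k) []).headD 0)).getD
        (min (bitsToNat t) ((bpoly Tm).eval z.length)) false] := by
  have h1 : ¬ bitsToNat κ < 1 := by omega
  have h2 : ¬ bitsToNat κ < 2 := by omega
  have h3 : ¬ bitsToNat κ < 3 := by omega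
  have h4 : ¬ bitsToNat κ < 4 := by omega
  apply normBit_of_eq
  rw [Function.comp_apply, state_mkI, answerW,
    iteFn_apply_false (by rw [kindLt_W, decide_eq_false h1]),
    iteFn_apply_false (by rw [kindLt_W, decide_eq_false h2]),
    iteFn_apply_false (by rw [kindLt_W, decide_eq_false h3]),
    iteFn_apply_false (by rw [kindLt_W, decide_eq_false h4]), bitOf_W, topNumW_W z κ τ k p t _ hk]

end Export

/-! ### After the halting time the clocked configuration is the halting configuration -/

/-- **The clocked configuration past the halting time**: if `M` outputs `y` on `z` within `s`
steps and `haltAddr · s ≤ min τ Tm(|z|)`, then `cfgAt M Tm z τ` is the flat halting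
configuration with output `y` (`FlatProg.pflat_complete`) — its output stack holds the coded
output word. [cite: AroraBarakCC2009, §1.4.1 and Thm. 1.9] -/
theorem cfgAt_eq_phaltCfg {z y : List Bool} {s : ℕ} (τ : List Bool) (h : M.OutputsWithin z y s)
    (hτ : s * haltAddr (cM M) ≤ min (bitsToNat τ) (Tm.eval z.length)) :
    cfgAt M Tm z τ = phaltCfg M (π M) y :=
  pflat_complete M (π M) h hτ

end FlatClaim

end Literature.Computability.Complexity

end
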